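import Literature.AlgebraicGeometry.HodgeTheory.PicardLefschetzSymmetricA3
import HarnessLib

/-!
# F-B2PL re-cut: `picardLefschetz_symmetricA3` ⟸ (bifurcation theorem) ∧ (Picard–Lefschetz clauses for given
# bifurcation data) — the junction of programme B2-BIF (binder hB2 of crux K1-B)

Family `hodge`, layer `Literature/AlgebraicGeometry/HodgeTheory`, next to `PicardLefschetzSymmetricA3` (the named fact
hB2 = `picardLefschetz_symmetricA3` of crux K1-B of `Summits/HodgeConjecture/HodgeConjecture/Theses/SignSymmetricPowers.lean`,
stmt-HodgeConjecture-19716, with its two halves: (i) the BIFURCATION picture `IsSymmetricA3Bifurcation` of the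
symmetric two-parameter unfolding of an `A₃` point — AGZV II §5.2, bifurcation set of the boundary singularity `B₂` —
and (ii) the PICARD–LEFSCHETZ data along the two circles — AGZV II Thm. 2.15/2.14, Voisin II Thm. 3.16).  Written by the
prover seat `hodge-nonav-19716-p2` (g8, cell `hodge-nonav`) for the programme B2-BIF (memo
`HOME/memos/PROGRAMME-B2BIF-Bx-g12.md`), which PROVES half (i); this file is the junction letting the registry re-cut
the binder hB2 to its Picard–Lefschetz content (ii) once (i) is a theorem:

* `SymmetricA3PicardLefschetzClauses n d f₁ g₀ g₂ ψ εa` — conclusion (ii) of hB2 VERBATIM, as a predicate on the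
  branch function `ψ` and the radius `εa`;
* `picardLefschetz_symmetricA3_iff` — hB2 unfolds to `∀ datum, ∃ εa εb ψ, IsSymmetricA3Bifurcation … ∧ clauses` (`Iff.rfl`);
* `IsSymmetricA3Bifurcation.mono` — the bifurcation data may be shrunk in the radius `εa`;
  `SymmetricA3PicardLefschetzClauses.mono` — so may the clauses;
* `picardLefschetz_symmetricA3_of_bifurcation` — hB2 ⟸ (∀ datum, ∃ bifurcation data) ∧ hB2-PL, where hB2-PL (stated
  INLINE as the hypothesis `hPL`, not as a new named fact: the registry may name it when it re-cuts hB2) says that for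
  EVERY bifurcation datum `(εa, εb, ψ)` of a symmetric `A₃` datum the clauses (ii) hold for the same `ψ` on some radius
  `0 < εa' ≤ εa` (the sources of hB2 minus the bifurcation-set computation).

## References
* [ArnoldGuseinzadeVarchenko2012] AGZV II, Part I §5.2 (pp. 129–133), §2.9 Thm. 2.15, §2.8 Thm. 2.14, §2.1 Thm. 2.1.
* [Arnold1981] V. I. Arnold, *Singularity Theory*, LMS LNS 53, Theorem 2 (bifurcation diagram of `B_μ`), p. 247.
* [VoisinHodgeII2003] C. Voisin, *Hodge Theory and Complex Algebraic Geometry II*, §3.2.1 Thm. 3.16, Cor. 3.17, Rem. 3.21.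
-/

noncomputable section

open CategoryTheory AlgebraicGeometry MvPolynomial
open Literature.AlgebraicTopology.SingularHomology
open Literature.AlgebraicGeometry.Motives Literature.AlgebraicGeometry.Motives.UniversalHypersurface

namespace Literature.AlgebraicGeometry.HodgeTheory

section HodgeTheory

/-- **The Picard–Lefschetz clauses (ii) of F-B2PL**, verbatim, as a predicate on the branch function `ψ` and the
radius `εa`: for `n, d ≥ 1`, every `hU`, every `0 < |a'| < εa`, every base point `t₀` with form
`f₁ + a' g₂ + (ψ a'/2) g₀` and every pair of loops around `b = 0` and `b = ψ a'`, the `A₃` chain `e₁, e₂, e₃` of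
vanishing cycles with Picard–Lefschetz data along the two circles, `c₀·B(e₁,e₂) = ±1`, `c₀·B(e₂,e₃) = ±1`, and
non-commuting rational transports. [cite: ArnoldGuseinzadeVarchenko2012, Part I §5.2 (pp. 129–133), §2.9 Thm. 2.15, §2.8 Thm. 2.14]
[cite: VoisinHodgeII2003, §3.2.1 Thm. 3.16, Cor. 3.17, Rem. 3.21] -/
def SymmetricA3PicardLefschetzClauses (n d : ℕ) (f₁ g₀ g₂ : MvPolynomial (Fin (n + 2)) ℂ) (ψ : ℂ → ℂ)
    (εa : ℝ) : Prop :=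
  ∀ (hn : 1 ≤ n) (hd : 1 ≤ d) (hU : IsCohomologicallyLocallyTrivialOn (family ℂ n d) Set.univ)
    (a' : ℂ), ‖a'‖ < εa → a' ≠ 0 →
    ∀ (t₀ : ComplexPoints (base ℂ n d)),
      pointForm ℂ n d t₀ = f₁ + a' • g₂ + (ψ a' / 2) • g₀ →
      ∀ (γ₁ γ₂ : Path t₀ t₀),
        (∀ θ : unitInterval, pointForm ℂ n d (γ₁ θ) =
          f₁ + a' • g₂ + (ψ a' / 2 * Complex.exp (2 * Real.pi * Complex.I * ((θ : ℝ) : ℂ))) • g₀) →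
        (∀ θ : unitInterval, pointForm ℂ n d (γ₂ θ) =
          f₁ + a' • g₂ +
            (ψ a' - ψ a' / 2 * Complex.exp (2 * Real.pi * Complex.I * ((θ : ℝ) : ℂ))) • g₀) →
        let hX : IsSmoothProjective n (fiberOver (family ℂ n d) t₀) :=
          (isSmoothProjectiveFamily_family ℂ hn hd).isSmoothProjective t₀
        let B : bettiCohomology (fiberOver (family ℂ n d) t₀) n →
            bettiCohomology (fiberOver (family ℂ n d) t₀) n → ℚ :=
          fun x y ↦ BettiUniverse.tr hX (n + n) (BettiUniverse.cup (fiberOver (family ℂ n d) t₀) n n x y)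
        ∃ (c₀ : ℚ) (e₁ e₂ e₃ : bettiCohomology (fiberOver (family ℂ n d) t₀) n),
          IsPicardLefschetzData n d 1 hn hd hU γ₁ ![e₂] c₀ ∧
          IsPicardLefschetzData n d 2 hn hd hU γ₂ ![e₁, e₃] c₀ ∧
          (c₀ * B e₁ e₂ = 1 ∨ c₀ * B e₁ e₂ = -1) ∧
          (c₀ * B e₂ e₃ = 1 ∨ c₀ * B e₂ e₃ = -1) ∧
          ∃ T₁ T₂ : bettiCohomology (fiberOver (family ℂ n d) t₀) n ≃ₗ[ℚ]
              bettiCohomology (fiberOver (family ℂ n d) t₀) n,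
            IsRatTransport (family ℂ n d) n hU (loopClassUniv n d γ₁) T₁ ∧
            IsRatTransport (family ℂ n d) n hU (loopClassUniv n d γ₂) T₂ ∧
            T₁.trans T₂ ≠ T₂.trans T₁

/-- **F-B2PL unfolds to «bifurcation data ∧ Picard–Lefschetz clauses».** [cite: ArnoldGuseinzadeVarchenko2012, Part I §5.2] -/
theorem picardLefschetz_symmetricA3_iff :
    picardLefschetz_symmetricA3 ↔
      ∀ (n d : ℕ) (f₁ g₀ g₂ : MvPolynomial (Fin (n + 2)) ℂ) (j k : Fin (n + 2)) (a : Fin (n + 2) → ℂˣ),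
        f₁.IsHomogeneous d → g₀.IsHomogeneous d → g₂.IsHomogeneous d → IsSymmetricA3Datum f₁ g₀ g₂ j k a →
        ∃ (εa εb : ℝ) (ψ : ℂ → ℂ), IsSymmetricA3Bifurcation f₁ g₀ g₂ j a εa εb ψ ∧
          SymmetricA3PicardLefschetzClauses n d f₁ g₀ g₂ ψ εa :=
  Iff.rfl

variable {n d : ℕ} {f₁ g₀ g₂ : MvPolynomial (Fin (n + 2)) ℂ} {j k : Fin (n + 2)} {a : Fin (n + 2) → ℂˣ}
  {εa εb : ℝ} {ψ : ℂ → ℂ}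

/-- **Shrinking the radius of a bifurcation datum.** [cite: ArnoldGuseinzadeVarchenko2012, Part I §5.2] -/
theorem IsSymmetricA3Bifurcation.mono (h : IsSymmetricA3Bifurcation f₁ g₀ g₂ j a εa εb ψ) {εa' : ℝ}
    (h0 : 0 < εa') (hle : εa' ≤ εa) : IsSymmetricA3Bifurcation f₁ g₀ g₂ j a εa' εb ψ := by
  obtain ⟨-, hεb, hdiff, hψ0, hψne, hψb, hns, hnod⟩ := h
  exact ⟨h0, hεb, hdiff.mono (Metric.ball_subset_ball hle), hψ0, fun a' ha => hψne a' (lt_of_lt_of_le ha hle),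
    fun a' ha => hψb a' (lt_of_lt_of_le ha hle), fun a' b ha hb => hns a' b (lt_of_lt_of_le ha hle) hb,
    fun a' ha => hnod a' (lt_of_lt_of_le ha hle)⟩

/-- **Shrinking the radius of the Picard–Lefschetz clauses.** [cite: ArnoldGuseinzadeVarchenko2012, Part I §5.2] -/
theorem SymmetricA3PicardLefschetzClauses.mono (h : SymmetricA3PicardLefschetzClauses n d f₁ g₀ g₂ ψ εa) {εa' : ℝ}
    (hle : εa' ≤ εa) : SymmetricA3PicardLefschetzClauses n d f₁ g₀ g₂ ψ εa' :=
  fun hn hd hU a' ha ha0 => h hn hd hU a' (lt_of_lt_of_le ha hle) ha0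

/-- **The junction: F-B2PL from the bifurcation theorem and hB2-PL.**  If every symmetric `A₃` datum admits
bifurcation data (programme B2-BIF) and, for every bifurcation datum, the Picard–Lefschetz clauses (ii) hold for its
`ψ` on some radius `0 < εa' ≤ εa` (hB2-PL, inline), then `picardLefschetz_symmetricA3` holds (shrink the bifurcation
datum to the radius of the clauses). [cite: ArnoldGuseinzadeVarchenko2012, Part I §5.2] -/
theorem picardLefschetz_symmetricA3_of_bifurcation
    (hBif : ∀ (n d : ℕ) (f₁ g₀ g₂ : MvPolynomial (Fin (n + 2)) ℂ) (j k : Fin (n + 2)) (a : Fin (n + 2) → ℂˣ),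
      f₁.IsHomogeneous d → g₀.IsHomogeneous d → g₂.IsHomogeneous d → IsSymmetricA3Datum f₁ g₀ g₂ j k a →
      ∃ (εa εb : ℝ) (ψ : ℂ → ℂ), IsSymmetricA3Bifurcation f₁ g₀ g₂ j a εa εb ψ)
    (hPL : ∀ (n d : ℕ) (f₁ g₀ g₂ : MvPolynomial (Fin (n + 2)) ℂ) (j k : Fin (n + 2)) (a : Fin (n + 2) → ℂˣ),
      f₁.IsHomogeneous d → g₀.IsHomogeneous d → g₂.IsHomogeneous d → IsSymmetricA3Datum f₁ g₀ g₂ j k a →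
      ∀ (εa εb : ℝ) (ψ : ℂ → ℂ), IsSymmetricA3Bifurcation f₁ g₀ g₂ j a εa εb ψ →
        ∃ εa' : ℝ, 0 < εa' ∧ εa' ≤ εa ∧ SymmetricA3PicardLefschetzClauses n d f₁ g₀ g₂ ψ εa') :
    picardLefschetz_symmetricA3 := by
  intro n d f₁ g₀ g₂ j k a hf₁ hg₀ hg₂ hD
  obtain ⟨εa, εb, ψ, hB⟩ := hBif n d f₁ g₀ g₂ j k a hf₁ hg₀ hg₂ hD
  obtain ⟨εa', h0, hle, hcl⟩ := hPL n d f₁ g₀ g₂ j k a hf₁ hg₀ hg₂ hD εa εb ψ hB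
  exact ⟨εa', εb, ψ, hB.mono h0 hle, hcl⟩

/-- Conversely the clauses of hB2 for its own bifurcation datum: `picardLefschetz_symmetricA3` provides SOME
bifurcation datum with the clauses on the full radius. [cite: ArnoldGuseinzadeVarchenko2012, Part I §5.2] -/
theorem picardLefschetz_symmetricA3.exists_clauses (H : picardLefschetz_symmetricA3) (hf₁ : f₁.IsHomogeneous d)
    (hg₀ : g₀.IsHomogeneous d) (hg₂ : g₂.IsHomogeneous d) (hD : IsSymmetricA3Datum f₁ g₀ g₂ j k a) :
    ∃ (εa εb : ℝ) (ψ : ℂ → ℂ), IsSymmetricA3Bifurcation f₁ g₀ g₂ j a εa εb ψ ∧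
      SymmetricA3PicardLefschetzClauses n d f₁ g₀ g₂ ψ εa :=
  H n d f₁ g₀ g₂ j k a hf₁ hg₀ hg₂ hD

end HodgeTheory

end Literature.AlgebraicGeometry.HodgeTheory

end
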